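import Literature.Analysis.FluidPDE.StatisticalSolution
import HarnessLib

/-!
# Steady weak solutions of the forced Navier–Stokes equations on `T^d` (Temam, Ch. II §1)

Trunk FluidKinetic (`Literature/Analysis/FluidPDE`); named facts requested by the route
`CoherentStates` (cruxes #2, #4; work item `wi-03663`), over the tree's steady weak solutions
`Literature.Torus.IsSteadyWeakSolution ν f u` (`StatisticalSolution.lean`: `u ∈ H = Torus.energySpace d`,
`(f, w) + ν (u, Δw) + ∫ (u ⊗ u) : ∇w = 0` for all `w ∈ 𝒱`), the space `V = Torus.energySpaceV d`
and the spectral enstrophy `Torus.eGradNormSq` (`‖∇u‖²_{L²}`).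

* `Temam1979_exists_steadyWeakSolution` — **existence for every viscosity** (Temam 1979, Ch. II,
  Thm. 1.2): for `d ≤ 4`, `ν > 0` and `f ∈ L²(T^d)`, there is `u ∈ V` which is a steady weak
  solution.
* `Temam1979_steadyWeakSolution_energy_eq` — the **energy equation** `ν ‖∇u‖² = (f, u)` of every
  steady weak solution `u ∈ V`, `d ≤ 4` (Temam 1979, Ch. II, (1.21)–(1.22) in the proof of
  Thm. 1.2: take `v = u`, `b(u, u, u) = 0`).
* `Temam1979_steadyWeakSolution_smooth` — **regularity** (Temam 1979, Ch. II, Prop. 1.1): for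
  `d ≤ 3` and `f ∈ C^∞`, every steady weak solution `u ∈ V` is (a.e. equal to) a `C^∞` field.
* API: `exists_isSteadyWeakSolution`, and `exists_isStationaryStatisticalSolution` — combined
  with the tree fact `isStationaryStatisticalSolution_dirac`, a stationary statistical solution
  exists for every `ν > 0`, `f ∈ L²`, `d ≤ 4`.

## On the source and its setting

Temam (1979), Ch. II §1, states Thm. 1.2 ("Problem 1.1 has at least one solution `u ∈ V`") and
the uniqueness theorem for `ν` large for a bounded domain `Ω ⊂ ℝⁿ`, `n ≤ 4`, with the
homogeneous Dirichlet condition and `f ∈ H⁻¹(Ω)ⁿ`; the proof (Galerkin approximation on a basis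
of `V`, existence of the finite-dimensional approximations by the Brouwer-type Lemma 1.4, the a
priori bound `ν ‖u_m‖ ≤ ‖f‖_{V'}` from `b(u_m, u_m, u_m) = 0`, weak compactness in `V` and
compactness of `V ↪ H` to pass to the limit in `b`) uses only the Hilbert triple `V ⊂ H ⊂ V'`
with `V ↪ H` compact, coercivity of `((·, ·))` on `V`, and `b(u, v, v) = 0` with `b` continuous
on `V³` (`n ≤ 4`, Lemma 1.2/(1.13)); these hold verbatim for the mean-zero space-periodic spaces
`H`, `V` on `T^d`, `d ≤ 4` (Temam, Ch. I §1.4, periodic case (1.31); Foias–Manley–Rosa–Temam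
2001, Ch. II §§5–7), which is the setting of the tree and of the facts below. The forcing is
taken in `L² ⊂ H⁻¹` (only its Leray projection matters, automatically, since test fields lie in
`𝒱`); the printed bound `‖u‖_V ≤ ‖f‖_{V'}/ν` follows from the energy equation and is not
restated (the tree has no `V'` norm).

## Mathlib / tree reuse

`MeasureTheory.MemLp`, `Filter.EventuallyEq` (`=ᵐ`), `ENNReal.toReal`; tree: `Torus.energySpace`,
`Torus.energySpaceV`, `Torus.IsSteadyWeakSolution`, `Torus.pairing`, `Torus.eGradNormSq`,
`Torus.IsSmooth`, `Torus.IsStationaryStatisticalSolution`, `Torus.isStationaryStatisticalSolution_dirac`.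
Mathlib has no Navier–Stokes theory.

## References

* R. Temam, *Navier–Stokes Equations: Theory and Numerical Analysis*, North-Holland (1979),
  Ch. II §1: Thm. 1.2 (existence of stationary weak solutions, `n ≤ 4`), (1.21)–(1.22) (energy
  equation), Prop. 1.1 (regularity); Ch. I §1.4 (space-periodic function spaces).
* C. Foias, O. Manley, R. Rosa, R. Temam, *Navier–Stokes Equations and Turbulence*, CUP (2001),
  Ch. II §§5–7 (periodic setting, steady states (7.1)–(7.2)).
-/

noncomputable section

open MeasureTheory
open scoped ENNReal

namespace Literature.Analysis.FluidPDE

namespace Torus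

variable {d : Type*} [Fintype d] [DecidableEq d]

/-- Local notation for the real Hilbert space `L²(T^d; ℝ^d)`. -/
local notation "L2T " d':max => Lp (EuclideanSpace ℝ d') 2 (volume : Measure (UnitAddTorus d'))

/-- **Existence of steady weak solutions for every viscosity** (Temam 1979, Ch. II, Thm. 1.2, in
the space-periodic mean-zero setting of Ch. I §1.4). Let `d ≤ 4`, `ν > 0` and
`f ∈ L²(T^d; ℝ^d)`. Then the stationary Navier–Stokes problem
`-ν Δu + (u·∇)u + ∇p = f`, `div u = 0`, `∫ u = 0` has at least one weak solution `u ∈ V`: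
`u ∈ H` with one derivative in `L²` (`Torus.energySpaceV`) and
`(f, w) + ν (u, Δw) + ∫ (u ⊗ u) : ∇w = 0` for every `w ∈ 𝒱` (`Torus.IsSteadyWeakSolution`).
No smallness of the data is required (uniqueness needs `ν` large relative to `f`). Temam prints
the theorem for bounded `Ω ⊂ ℝⁿ`, `n ≤ 4`, Dirichlet data, `f ∈ H⁻¹`; see the module docstring
for the (verbatim) transfer to `T^d`. [cite: Temam1979, Ch. II Thm. 1.2] -/
def Temam1979_exists_steadyWeakSolution : Prop :=
  ∀ {d : Type} [Fintype d] [DecidableEq d] (_hd : Fintype.card d ≤ 4) {ν : ℝ} (_hν : 0 < ν)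
    {f : UnitAddTorus d → EuclideanSpace ℝ d} (_hf : MemLp f 2 volume),
    ∃ u : FunctionSpaces.Torus.energySpace d, (u : L2T d) ∈ FunctionSpaces.Torus.energySpaceV d ∧ IsSteadyWeakSolution ν f u

/-- **Energy equation of steady weak solutions** (Temam 1979, Ch. II §1, (1.21)–(1.22) in the
proof of Thm. 1.2). Let `d ≤ 4`, `f ∈ L²`, and let `u ∈ V` be a steady weak solution. Then
`ν ‖∇u‖²_{L²} = (f, u)`: for `d ≤ 4` the trilinear form `b` is continuous on `V³`
(Lemma 1.2/(1.13)), so the weak formulation extends from `w ∈ 𝒱` to `w ∈ V`, and `w = u` gives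
the identity since `b(u, u, u) = 0` (Lemma 1.3). Here `‖∇u‖²` is the spectral
`Torus.eGradNormSq` (finite for `u ∈ V`) and `(f, u)` is `Torus.pairing`.
[cite: Temam1979, Ch. II Thm. 1.2, (1.21)–(1.22)] -/
def Temam1979_steadyWeakSolution_energy_eq : Prop :=
  ∀ {d : Type} [Fintype d] [DecidableEq d] (_hd : Fintype.card d ≤ 4) {ν : ℝ}
    {f : UnitAddTorus d → EuclideanSpace ℝ d} (_hf : MemLp f 2 volume) {u : FunctionSpaces.Torus.energySpace d}
    (_hV : (u : L2T d) ∈ FunctionSpaces.Torus.energySpaceV d) (_hu : IsSteadyWeakSolution ν f u),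
    ν * (FunctionSpaces.Torus.eGradNormSq ((u : L2T d) : UnitAddTorus d → EuclideanSpace ℝ d)).toReal =
      pairing (u : L2T d) f

/-- **Regularity of steady weak solutions** (Temam 1979, Ch. II, Prop. 1.1, space-periodic case).
Let `d ≤ 3`, `f ∈ C^∞(T^d; ℝ^d)`, and let `u ∈ V` be a steady weak solution with viscosity
`ν > 0`. Then `u` is a.e. equal to a `C^∞` vector field (and, with the associated smooth
pressure, solves the equations classically). [cite: Temam1979, Ch. II Prop. 1.1] -/
def Temam1979_steadyWeakSolution_smooth : Prop :=
  ∀ {d : Type} [Fintype d] [DecidableEq d] (_hd : Fintype.card d ≤ 3) {ν : ℝ} (_hν : 0 < ν)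
    {f : UnitAddTorus d → EuclideanSpace ℝ d} (_hf : FunctionSpaces.Torus.IsSmooth f) {u : FunctionSpaces.Torus.energySpace d}
    (_hV : (u : L2T d) ∈ FunctionSpaces.Torus.energySpaceV d) (_hu : IsSteadyWeakSolution ν f u),
    ∃ v : UnitAddTorus d → EuclideanSpace ℝ d,
      FunctionSpaces.Torus.IsSmooth v ∧ ((u : L2T d) : UnitAddTorus d → EuclideanSpace ℝ d) =ᵐ[volume] v

/-! ### API -/

/-- Existence of a steady weak solution in `H` (forgetting `u ∈ V`). [folklore] -/
theorem exists_isSteadyWeakSolution (h : Temam1979_exists_steadyWeakSolution) {d : Type}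
    [Fintype d] [DecidableEq d] (hd : Fintype.card d ≤ 4) {ν : ℝ} (hν : 0 < ν)
    {f : UnitAddTorus d → EuclideanSpace ℝ d} (hf : MemLp f 2 volume) :
    ∃ u : FunctionSpaces.Torus.energySpace d, IsSteadyWeakSolution ν f u := by
  obtain ⟨u, -, hu⟩ := h hd hν hf
  exact ⟨u, hu⟩

/-- Existence of a steady weak solution satisfying the energy equation
`ν ‖∇u‖² = (f, u)` (Temam's Thm. 1.2 together with (1.22)). [folklore] -/
theorem exists_isSteadyWeakSolution_energy_eq (h : Temam1979_exists_steadyWeakSolution)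
    (he : Temam1979_steadyWeakSolution_energy_eq) {d : Type} [Fintype d] [DecidableEq d]
    (hd : Fintype.card d ≤ 4) {ν : ℝ} (hν : 0 < ν) {f : UnitAddTorus d → EuclideanSpace ℝ d}
    (hf : MemLp f 2 volume) :
    ∃ u : FunctionSpaces.Torus.energySpace d, (u : L2T d) ∈ FunctionSpaces.Torus.energySpaceV d ∧ IsSteadyWeakSolution ν f u ∧
      ν * (FunctionSpaces.Torus.eGradNormSq ((u : L2T d) : UnitAddTorus d → EuclideanSpace ℝ d)).toReal =
        pairing (u : L2T d) f := by
  obtain ⟨u, hV, hu⟩ := h hd hν hf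
  exact ⟨u, hV, hu, he hd hf hV hu⟩

/-- **A stationary statistical solution exists for every viscosity**: the Dirac mass at a steady
weak solution `u ∈ V` (Temam's existence theorem combined with the tree fact
`isStationaryStatisticalSolution_dirac`, FMRT 2001, Ch. IV §1.2). [folklore] -/
theorem exists_isStationaryStatisticalSolution (h : Temam1979_exists_steadyWeakSolution)
    {d : Type} [Fintype d] [DecidableEq d]
    (hdirac : isStationaryStatisticalSolution_dirac (d := d)) (hd : Fintype.card d ≤ 4) {ν : ℝ}
    (hν : 0 < ν) {f : UnitAddTorus d → EuclideanSpace ℝ d} (hf : MemLp f 2 volume) :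
    ∃ μ : Measure (FunctionSpaces.Torus.energySpace d), IsStationaryStatisticalSolution ν f μ := by
  obtain ⟨u, hV, hu⟩ := h hd hν hf
  exact ⟨Measure.dirac u, hdirac hν.le hf hd hV hu⟩

/-- For smooth forcing in `d ≤ 3`, a smooth steady state exists for every viscosity (existence
plus regularity). [folklore] -/
theorem exists_smooth_steadyWeakSolution (h : Temam1979_exists_steadyWeakSolution)
    (hs : Temam1979_steadyWeakSolution_smooth) {d : Type} [Fintype d] [DecidableEq d]
    (hd : Fintype.card d ≤ 3) {ν : ℝ} (hν : 0 < ν) {f : UnitAddTorus d → EuclideanSpace ℝ d}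
    (hf : FunctionSpaces.Torus.IsSmooth f) (hf2 : MemLp f 2 volume) :
    ∃ (u : FunctionSpaces.Torus.energySpace d) (v : UnitAddTorus d → EuclideanSpace ℝ d),
      IsSteadyWeakSolution ν f u ∧ FunctionSpaces.Torus.IsSmooth v ∧
        ((u : L2T d) : UnitAddTorus d → EuclideanSpace ℝ d) =ᵐ[volume] v := by
  obtain ⟨u, hV, hu⟩ := h (hd.trans (by norm_num)) hν hf2
  obtain ⟨v, hv, huv⟩ := hs hd hν hf hV hu
  exact ⟨u, v, hu, hv, huv⟩

end Torus

end Literature.Analysis.FluidPDE
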